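import Literature.AlgebraicGeometry.Frobenioids.MotivatingExamplesSubProofs3
import Literature.NumberTheory.NumberFields.BauerDegreeOnePlaces
import HarnessLib

/-!
# [FrdI] Thm. 6.4 (iv): the two "Tchebotarev" sub-nodes T64iv/L03 (a completely split prime exists) and
# T64iv/L06 (Bauer, [NSW] 12.2.5) — DISCHARGED

Mochizuki, *The geometry of Frobenioids I* (2008), proof of Theorem 6.4 (iv), kurims p. 116 l. 19–33:
"by Tchebotarev's density theorem [cf., e.g., [Lang2], Chapter VIII, §4, Theorem 10], it follows that
`[L_i : ℚ]` is equal to the maximum of the `deg(L_i, v_i)` … `p_i` splits completely in `L_i` if and only if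
`deg(L_i, v_i) = [L_i : ℚ]`" and "Since `L₁` is Galois, it thus follows … — again by Tchebotarev's density
theorem — cf., e.g., [NSW], Theorem 12.2.5 — that `L₁ ⊆ L₂`". [cite: MochizukiFrdI2008, Thm. 6.4 (iv) p.116]

The cell's sub-DAG (abc-iut-L1-t1's `MotivatingExamplesSub.lean`) recorded both as classical NAMED FACTS,
`Thm64iv_L03_existsSplitPrime` and `Thm64iv_L06_Bauer`, in the vocabulary `placesOver L p` /
`SplitsCompletely L p` (finite places of residue characteristic `p`; `p` prime with `[L : ℚ]` places above
it). This PROOF-ONLY file closes them from the tree's kernel-proved Chebotarev/decomposition-field chain: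
`Literature.NumberTheory.NumberFields.SplitPrimesGaloisClosure` (every number field has infinitely many
completely split primes) and `Literature.NumberTheory.NumberFields.BauerDegreeOnePlaces` (Bauer's theorem
in the degree-one form), through the bridge `splitsCompletely_iff_of_prime` between the sub-DAG's
`SplitsCompletely` and the trunk's `Literature.NumberTheory.GaloisRepresentations.SplitsCompletely`
(abc-iut-L1-t1's `ncard_placesOver_eq` + the trunk's `SplitsCompletelyCriteria`).
-/

noncomputable section

namespace Literature.AlgebraicGeometry.Frobenioids

open NumberField IsDedekindDomain Ideal
open Literature.NumberTheory Literature.NumberTheory.NumberFields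

/-! ### The bridge between the two `SplitsCompletely` -/

section Bridge

variable {L : Type} [Field L] [NumberField L]

/-- **`SplitsCompletely L p` (sub-DAG: `p` prime with `[L : ℚ]` places above it) iff `p` is prime and splits
completely in the trunk's sense** (`p` unramified in `L`, every residue degree above `p` equal to one):
"`p_i` splits completely in `L_i` if and only if `deg(L_i, v_i) = [L_i : ℚ]`".
[cite: MochizukiFrdI2008, Thm. 6.4 (iv) p.116] -/
theorem splitsCompletely_iff_prime_and (p : ℕ) :
    SplitsCompletely L p ↔ p.Prime ∧ GaloisRepresentations.SplitsCompletely L p := by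
  constructor
  · rintro ⟨hp, hn⟩
    have hpb : span {(p : ℤ)} ≠ ⊥ := by simp [hp.ne_zero]
    haveI : (span {(p : ℤ)}).IsMaximal :=
      ((span_singleton_prime (by exact_mod_cast hp.ne_zero)).mpr (Nat.prime_iff_prime_int.mp hp)).isMaximal hpb
    refine ⟨hp, GaloisRepresentations.splitsCompletely_of_ncard_primesOver_eq_finrank hp ?_⟩
    rw [← IsDedekindDomain.coe_primesOverFinset hpb (𝓞 L), Set.ncard_coe_finset, ← ncard_placesOver_eq hp]
    exact hn
  · rintro ⟨hp, h⟩
    have hpb : span {(p : ℤ)} ≠ ⊥ := by simp [hp.ne_zero]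
    haveI : (span {(p : ℤ)}).IsMaximal :=
      ((span_singleton_prime (by exact_mod_cast hp.ne_zero)).mpr (Nat.prime_iff_prime_int.mp hp)).isMaximal hpb
    refine ⟨hp, ?_⟩
    rw [ncard_placesOver_eq hp, ← Set.ncard_coe_finset, IsDedekindDomain.coe_primesOverFinset hpb (𝓞 L)]
    exact GaloisRepresentations.ncard_primesOver_eq_finrank_of_splitsCompletely hp h

end Bridge

/-! ### T64iv/L03 and T64iv/L06 discharged -/

/-- **T64iv/L03 DISCHARGED** ("by Tchebotarev's density theorem … `[L_i : ℚ]` is equal to the maximum of the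
`deg(L_i, v_i)`"): every number field has a completely split rational prime — the trunk's
`infinite_setOf_splitsCompletely` (Chebotarev with trivial target in the Galois closure, descent to the
subfield). [cite: MochizukiFrdI2008, Thm. 6.4 (iv) p.116] -/
theorem Thm64iv_L03_existsSplitPrime_holds : Thm64iv_L03_existsSplitPrime := by
  intro L _ _
  obtain ⟨p, hp, h⟩ := NumberFields.exists_splitsCompletely L
  exact ⟨p, (splitsCompletely_iff_prime_and p).mpr ⟨hp, h⟩⟩

/-- Moreover there are INFINITELY many completely split primes (the form Chebotarev actually gives).
[cite: MochizukiFrdI2008, Thm. 6.4 (iv) p.116] -/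
theorem infinite_setOf_splitsCompletely (L : Type) [Field L] [NumberField L] :
    {p : ℕ | SplitsCompletely L p}.Infinite :=
  (NumberFields.infinite_setOf_splitsCompletely L).mono fun p hp =>
    (splitsCompletely_iff_prime_and p).mpr hp

/-- **T64iv/L06 DISCHARGED** ("again by Tchebotarev's density theorem — cf., e.g., [NSW], Theorem 12.2.5 —
that `L₁ ⊆ L₂`"): Bauer's theorem in the degree-one form, the trunk's
`nonempty_algHom_of_degreeOne_splitsCompletely`. [cite: MochizukiFrdI2008, Thm. 6.4 (iv) p.116] -/
theorem Thm64iv_L06_Bauer_holds : Thm64iv_L06_Bauer := by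
  intro L₁ _ _ L₂ _ _ hgal S h
  haveI := hgal
  obtain ⟨φ⟩ := NumberFields.nonempty_algHom_of_degreeOne_splitsCompletely L₁ L₂ S
    (fun p hp hpS hw => by
      obtain ⟨w, hw⟩ := hw
      refine ((splitsCompletely_iff_prime_and p).mp (h p hp hpS ⟨FinitePlace.mk w, ?_⟩)).2
      rw [FinitePlace.maximalIdeal_mk]
      exact hw)
  exact ⟨φ.toRingHom⟩

/-- Hence also **T64iv/L04** unconditionally (abc-iut-L1-t1's `Thm64iv_L04_degreeEq_of` applied to L03):
a residue-characteristic-preserving bijection of finite places preserves split degrees, degrees over `ℚ` and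
complete splitting. [cite: MochizukiFrdI2008, Thm. 6.4 (iv) p.116] -/
theorem Thm64iv_L04_degreeEq_holds : Thm64iv_L04_degreeEq :=
  Thm64iv_L04_degreeEq_of Thm64iv_L03_existsSplitPrime_holds

end Literature.AlgebraicGeometry.Frobenioids

end
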